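import Mathlib
import HarnessLib

/-!
# Hintz 2026, Lemma 6.11, eq. (6.21): the zero-energy boundary pairing
# `⟨[□_{g_b}, t_*] ω₍₀₎, ω₍₀₎*⟩ = 4π` — the horizon-side angular integral, for every subextremal Kerr

CITATION HEADER (lean-in-tree rule 2026-08-18).  `Hintz2026` = P. Hintz, *Nonlinear stability of subextremal Kerr
black holes*, arXiv:2606.28253 **v2** (2026), an UNREFEREED preprint and the CLAIM under adjudication in this library
(`Literature.Geometry.Lorentzian.hintz_kerr_stability_subextremal_cauchy`, `@[claim "Hintz2026" "under-review"]`);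
TeX lines `H l.N` refer to its source `kerr-stab-r.tex`.  The identity treated here, eq. (6.21) `EqWG0Pair1` of
Lemma 6.11 (`LemmaWG0Pair`, H l.6172–6191, p. 120), is IMPORTED there (proof, H l.6193: "was proved in [Gluing III,
Lemma 3.8] using a 'boundary pairing' computation") from `Hintz2024GluingIII` = P. Hintz, *Gluing small black holes
along timelike geodesics III*, arXiv:2408.06715 (2024, unrefereed), Lemma 3.8, first identity (held as corpus `paper:arxiv-2408.06715`, TeX chunks p0027–p0028).
This file does NOT certify any analytic statement of either paper (function spaces, Fredholm setting, the cokernel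
statement of Lemma 6.10).  It PROVES the elementary integral to which the pairing (6.21) reduces when it is evaluated
on the HORIZON side — a route independent of the printed proof, which evaluates the same pairing at `r = ∞` from
Minkowski leading-order data — and records, in the docstrings, the engine-certified reduction.  Written by the audit
cell `pub-kerr` (HINTZ-PLAN.md P22; engines `run/shared/lean/pub/pub-kerr/code/adep1-g14/pair1_*`).

## What is printed

Lemma 6.10 (`LemmaWGMode0`, H l.6156–6167; "the content of [AHW24, Thm 5.1(2)]"): with `t₀ = 𝔱 + ∫(r²+a²)/μ_b dr`,
`φ₀ = φ + ∫ a/μ_b dr` (ingoing Kerr-star coordinates), the kernel of `□̂_{g_b}(0)` is spanned by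
`ω₍₀₎ = (r/ϱ_a²)(dt₀ − a sin²θ dφ₀) + ((r_b⁺ − r)/μ_b) dr` and the cokernel by `ω₍₀₎* = δ(r − r_b⁺) dr`.
Lemma 6.11 (H l.6172–6179): "Using the spatial volume density `|dg_b|_X| = ϱ_a² sinθ |dr dθ dφ₀|` of the Kerr metric,
and the (indefinite) fiber inner product on `𝒯*_X` induced by `g_b`, we have
`⟨[□_{g_b}, t_*] ω₍₀₎, ω₍₀₎*⟩_{L²(X;𝒯*_X)} = 4π`."  Here `□_g = −g^{κλ}∇_κ∇_λ` (H l.4252) and `t_*` is the time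
function of Lemma 3.6, eq. (3.13): `t_* = t̃_* + T̃(r)` with `T̃ ∈ C^∞([𝔪₀,∞))` (H l.3629–3637), `t̃_* = t₀` up to an additive
constant for `r ≤ 3𝔪₀` (footnote to Lemma 6.10, H l.6158).  USE (proof of Prop. 6.12, H l.6232–6236, eq. (6.26)
`EqWGModeInner`): with `∂_σ□̂(0) = −i[□,t_*]^(0)`, (6.21) and (6.23) give `⟨f(0,σ̂,γ̂), ω₍₀₎*⟩ = 4π(−iσ̂ + c_bγ̂) ≠ 0`,
`c_b ∈ (3/4, 5/4)`, the non-degeneracy that removes the zero-energy kernel of the gauge potential wave operator.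
Gluing III, Lemma 3.8: the same identity, and "This also holds for `t̂ + F(r̂)` in place of `t̂`, for any smooth
function `F`" (proof: the extra contribution is `⟨□Fω, ω*⟩ = ⟨Fω, □*ω*⟩ = 0`).

## The horizon-side evaluation (engine-certified; NOT a kernel statement)

Since `ω₍₀₎*` is supported on `{r = r₊}` and `[□, t_*]` is a differential operator, (6.21) only involves `t_*` near
`r = r₊`, where `t_* = t₀ + F(r)`; by the printed `F(r)`-invariance (re-verified on the horizon side by engine A3: the
density below is even POINTWISE unchanged under `t₀ ↦ t₀ + F(r)`, identically in `(r₊, a, F′(r₊), F″(r₊))`) one may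
take `t₀` for `t_*`.  With `[□, t₀]ω = (□t₀)ω − 2 g^{t₀β}∇_β ω`, `ϱ² g^{rν} = μ δ^ν_r + (r²+a²) δ^ν_{t₀} + a δ^ν_{φ₀}`
(ingoing coordinates) and `μ(r₊) = 0`, the pairing equals `∫_{𝕊²} ϱ₊² g^{rν}([□,t₀]ω₍₀₎)_ν sinθ dθ dφ₀
= 2π ∫_{−1}^{1} I(x) dx`, `x = cos θ`, and three engines (A: sympy, exact rational arithmetic at 7 rational
`(r₊, r₋, a)` incl. the check `□_g ω₍₀₎ = 0`, and fully symbolic in `(r₊, a)`; B: mpmath, 40 digits, finite-difference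
Christoffel symbols, Gauss–Legendre quadrature, 7 values of `a/𝔪 ∈ [0, 0.99]`, error `< 10⁻³⁵`; A3: the
`F(r)`-invariance) certify the closed form
  `I(x) = ϱ₊² g^{rν}([□_{g_b}, t₀] ω₍₀₎)_ν |_{r = r₊} = (r₊² + a²)(r₊² − a²x²) / (r₊² + a²x²)²`
for ALL `r₊ > 0`, `a ∈ ℝ` (with `r₋ = a²/r₊`).  Observed cross-check: `I = −2ϱ₊² · P(r₊, x)` where
`P = −(r² + a²)(r² − a²x²)/(2ϱ⁶)` is the profile of (6.23) proved in
`Literature.Geometry.Lorentzian.Kerr.Ingoing.gradr_deltaStar_omega0_tstar` (`KerrZeroEnergyGaugePotential.lean`);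
see `horizonIntegrand_eq_profile` (a ring identity between the two closed forms; the geometric link is not claimed).

## What is proved here

* `hasDerivAt_horizonAntideriv`: `d/dx [ (r₊²+a²) x / (r₊² + a²x²) ] = I(x)` for `r₊ ≠ 0`;
* `integral_horizonIntegrand`: `∫_{−1}^{1} I(x) dx = 2`, hence `horizonPairing_eq` : `2π ∫_{−1}^{1} I = 4π` — for EVERY
  `r₊ ≠ 0` and EVERY `a` (no smallness of `|a|/𝔪`; the value does not even depend on `a`), i.e. granted the certified
  reduction, (6.21) holds verbatim on the full subextremal range, and in particular the coefficient `4π ≠ 0` of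
  `−iσ̂` in (6.26) is `b`-independent;
* `horizonIntegrand_schwarzschild` (`a = 0`: `I ≡ 1`), `horizonIntegrand_pos` (`I > 0` on `[−1,1]` when `a² < r₊²`,
  which holds for `|a| < 𝔪 ≤ r₊`), `horizonIntegrand_eq_profile`.

## References
* P. Hintz, arXiv:2606.28253v2 (2026) [key `Hintz2026`; claim under review]: Lemma 6.10, Lemma 6.11 eq. (6.21), proof
  of Prop. 6.12 eq. (6.26) (H l.6156–6236, pp. 120–122).
* P. Hintz, arXiv:2408.06715 (2024) [key `Hintz2024GluingIII`]: Lemma 3.8 (first identity) and its proof (corpus chunks p0027–p0028).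
* L. Andersson, D. Häfner, B. F. Whiting, *Mode analysis for the linearized Einstein equations on the Kerr metric: the
  large 𝔞 case*, JEMS (2024), doi:10.4171/jems/1544, Thm 5.1(2) (the source of Lemma 6.10; not used here).
-/

noncomputable section

open Real intervalIntegral

namespace Literature.Geometry.Lorentzian.Hintz2026.ZeroEnergyPairing

/-- The horizon-side pairing density of (6.21) as a function of `x = cos θ`:
`I(x) = ϱ₊² g^{rν}([□_{g_b}, t₀] ω₍₀₎)_ν |_{r=r₊} = (r₊² + a²)(r₊² − a²x²)/(r₊² + a²x²)²` (closed form certified by the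
engines A/A3/B of `code/adep1-g14`, see the module docstring; here it is simply DEFINED as this rational function of
the outer horizon radius `p = r₊`, the rotation parameter `a` and `x`).
[cite: Hintz2026, Lemma 6.11 eq. (6.21) (preprint; reduction engine-certified, not printed)] -/
def horizonIntegrand (p a x : ℝ) : ℝ :=
  (p ^ 2 + a ^ 2) * (p ^ 2 - a ^ 2 * x ^ 2) / (p ^ 2 + a ^ 2 * x ^ 2) ^ 2

/-- An antiderivative of `horizonIntegrand p a` in `x`: `(r₊² + a²) x / (r₊² + a²x²)`. [folklore] -/
def horizonAntideriv (p a x : ℝ) : ℝ :=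
  (p ^ 2 + a ^ 2) * x / (p ^ 2 + a ^ 2 * x ^ 2)

/-- Unfolding lemma for `horizonIntegrand`. [folklore] -/
theorem horizonIntegrand_def (p a x : ℝ) :
    horizonIntegrand p a x = (p ^ 2 + a ^ 2) * (p ^ 2 - a ^ 2 * x ^ 2) / (p ^ 2 + a ^ 2 * x ^ 2) ^ 2 := rfl

/-- Unfolding lemma for `horizonAntideriv`. [folklore] -/
theorem horizonAntideriv_def (p a x : ℝ) :
    horizonAntideriv p a x = (p ^ 2 + a ^ 2) * x / (p ^ 2 + a ^ 2 * x ^ 2) := rfl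

/-- The denominator `ϱ₊² = r₊² + a²x²` is positive as soon as `r₊ ≠ 0`. [folklore] -/
theorem rhoSq_pos {p : ℝ} (hp : p ≠ 0) (a x : ℝ) : 0 < p ^ 2 + a ^ 2 * x ^ 2 := by
  have h1 : 0 < p ^ 2 := by positivity
  nlinarith [mul_nonneg (sq_nonneg a) (sq_nonneg x)]

/-- Schwarzschild (`a = 0`): the density is identically `1`, so the pairing is `2π · 2 = 4π` = the area `4π` of the
unit sphere times `1` — the value the printed proof obtains at `r = ∞` from the Minkowski model
(Gluing III, proof of Lemma 3.8: "`4π lim_{ε↘0} ∫₀^∞ r̂⁻¹ [□,χ_ε]1 r̂² dr̂` is easily evaluated to equal `4π`").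
[cite: Hintz2024GluingIII, Lemma 3.8, proof] -/
theorem horizonIntegrand_schwarzschild {p : ℝ} (hp : p ≠ 0) (x : ℝ) : horizonIntegrand p 0 x = 1 := by
  have h1 : p ^ 2 ≠ 0 := pow_ne_zero 2 hp
  unfold horizonIntegrand
  field_simp
  ring

/-- `d/dx [(r₊²+a²) x/(r₊² + a²x²)] = (r₊²+a²)(r₊² − a²x²)/(r₊² + a²x²)²` for `r₊ ≠ 0`. [folklore] -/
theorem hasDerivAt_horizonAntideriv {p : ℝ} (hp : p ≠ 0) (a x : ℝ) :
    HasDerivAt (horizonAntideriv p a) (horizonIntegrand p a x) x := by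
  have hden : p ^ 2 + a ^ 2 * x ^ 2 ≠ 0 := (rhoSq_pos hp a x).ne'
  have h1 : HasDerivAt (fun y : ℝ => (p ^ 2 + a ^ 2) * y) ((p ^ 2 + a ^ 2) * 1) x :=
    (hasDerivAt_id x).const_mul (p ^ 2 + a ^ 2)
  have h2 : HasDerivAt (fun y : ℝ => p ^ 2 + a ^ 2 * y ^ 2) (a ^ 2 * (2 * x)) x := by
    have h := ((hasDerivAt_pow 2 x).const_mul (a ^ 2)).const_add (p ^ 2)
    simpa using h
  have h3 := (h1.div h2 hden).congr_deriv (g' := horizonIntegrand p a x) (by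
    unfold horizonIntegrand
    field_simp
    ring)
  show HasDerivAt (fun y : ℝ => (p ^ 2 + a ^ 2) * y / (p ^ 2 + a ^ 2 * y ^ 2)) (horizonIntegrand p a x) x
  exact h3

/-- `horizonIntegrand p a` is continuous on `ℝ` for `r₊ ≠ 0` (its denominator never vanishes). [folklore] -/
theorem continuous_horizonIntegrand {p : ℝ} (hp : p ≠ 0) (a : ℝ) : Continuous (horizonIntegrand p a) := by
  unfold horizonIntegrand
  apply Continuous.div (by fun_prop) (by fun_prop)
  intro x
  exact pow_ne_zero 2 (rhoSq_pos hp a x).ne'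

/-- **The angular integral of (6.21)**: `∫_{−1}^{1} (r₊²+a²)(r₊² − a²x²)/(r₊² + a²x²)² dx = 2` for every `r₊ ≠ 0`
and every `a ∈ ℝ` (fundamental theorem of calculus with the antiderivative `(r₊²+a²)x/(r₊²+a²x²)`, whose values
at `±1` are `±1`).  [cite: Hintz2026, Lemma 6.11 eq. (6.21) (preprint); Hintz2024GluingIII, Lemma 3.8] -/
theorem integral_horizonIntegrand {p : ℝ} (hp : p ≠ 0) (a : ℝ) :
    ∫ x in (-1 : ℝ)..1, horizonIntegrand p a x = 2 := by
  have hcont : ContinuousOn (horizonIntegrand p a) (Set.uIcc (-1 : ℝ) 1) :=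
    (continuous_horizonIntegrand hp a).continuousOn
  rw [integral_eq_sub_of_hasDerivAt (fun x _ => hasDerivAt_horizonAntideriv hp a x) (hcont.intervalIntegrable)]
  have h1 : p ^ 2 + a ^ 2 * (1 : ℝ) ^ 2 ≠ 0 := (rhoSq_pos hp a 1).ne'
  have h2 : p ^ 2 + a ^ 2 * (-1 : ℝ) ^ 2 ≠ 0 := (rhoSq_pos hp a (-1)).ne'
  unfold horizonAntideriv
  field_simp
  ring

/-- **(6.21) on the full subextremal range, granted the engine-certified reduction**: the horizon-side pairing
`2π ∫_{−1}^{1} I(x) dx` equals `4π` for EVERY outer horizon radius `r₊ ≠ 0` and EVERY `a` — no smallness of `|a|/𝔪`,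
and the value is independent of `(𝔪, a)`, as printed ("`= 4π`" with no `b`-dependence, H l.6176–6178).
[cite: Hintz2026, Lemma 6.11 eq. (6.21) (preprint); Hintz2024GluingIII, Lemma 3.8 (first identity)] -/
theorem horizonPairing_eq {p : ℝ} (hp : p ≠ 0) (a : ℝ) :
    2 * π * ∫ x in (-1 : ℝ)..1, horizonIntegrand p a x = 4 * π := by
  rw [integral_horizonIntegrand hp a]
  ring

/-- The density is POSITIVE on `[−1, 1]` whenever `a² < r₊²` — in particular for every subextremal Kerr black hole
(`|a| < 𝔪 ≤ r₊ = 𝔪 + √(𝔪² − a²)`, cf. `Kerr.Ingoing.sq_lt_rPlus_sq_of_abs_lt`); it degenerates (vanishes at the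
poles `x = ±1`) exactly in the extremal limit `|a| = r₊`. [folklore] -/
theorem horizonIntegrand_pos {p a x : ℝ} (hp : p ≠ 0) (ha : a ^ 2 < p ^ 2) (hx : x ^ 2 ≤ 1) :
    0 < horizonIntegrand p a x := by
  unfold horizonIntegrand
  have h0 : 0 < p ^ 2 + a ^ 2 * x ^ 2 := rhoSq_pos hp a x
  have h1 : 0 < p ^ 2 + a ^ 2 := by nlinarith [sq_nonneg a]
  have h2 : 0 < p ^ 2 - a ^ 2 * x ^ 2 := by nlinarith [mul_le_mul_of_nonneg_left hx (sq_nonneg a)]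
  exact div_pos (mul_pos h1 h2) (pow_pos h0 2)

/-- Cross-check with (6.23): the density `I(x)` equals `−2ϱ₊² · P` where `P = −(r₊²+a²)(r₊² − a²x²)/(2ϱ₊⁶)`,
`ϱ₊² = r₊² + a²x²`, is the closed form of the profile `ι_{∂_{t₀}} ι_{∇r} δ_g^* ω₍₀₎` at `r = r₊` proved in
`Literature.Geometry.Lorentzian.Kerr.Ingoing.gradr_deltaStar_omega0_tstar`.  (An identity between the two closed
forms only; no geometric relation between the two pairings of Lemma 6.11 is asserted.) [folklore] -/
theorem horizonIntegrand_eq_profile {p : ℝ} (hp : p ≠ 0) (a x : ℝ) :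
    horizonIntegrand p a x =
      -2 * (p ^ 2 + a ^ 2 * x ^ 2) *
        (-((p ^ 2 + a ^ 2) * (p ^ 2 - a ^ 2 * x ^ 2)) / (2 * (p ^ 2 + a ^ 2 * x ^ 2) ^ 3)) := by
  have h0 : p ^ 2 + a ^ 2 * x ^ 2 ≠ 0 := (rhoSq_pos hp a x).ne'
  unfold horizonIntegrand
  field_simp

end Literature.Geometry.Lorentzian.Hintz2026.ZeroEnergyPairing

end
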